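import Mathlib
import Summits.Ventures.HodgeRepro2.T5LocalNormIndex
import Summits.Ventures.HodgeRepro2.T5NormCharConductor
import Summits.Ventures.HodgeRepro2.T5RamifiedOddConductor
import Summits.Ventures.HodgeRepro2.T6N5TateTwist
import Summits.Ventures.HodgeRepro2.T6N5Hyp
import Summits.Ventures.HodgeRepro2.T6N5LocalDatum
import Summits.Ventures.HodgeRepro2.T6N5LocalHyp
import Summits.Ventures.HodgeRepro2.T6N5LocalHypSmooth
import Summits.Ventures.HodgeRepro2.T6N5Local
import Summits.Ventures.HodgeRepro2.T6N5LocalSmooth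
import Summits.Ventures.HodgeRepro2.T6N5LocalWeil
import Summits.Ventures.HodgeRepro2.T6N5LocalCharDatum
import Summits.Ventures.HodgeRepro2.T6N5LocalInertHyp
import Summits.Ventures.HodgeRepro2.T6N5LocalInert
import Summits.Ventures.HodgeRepro2.T6N5LocalInertWeil
import Summits.Ventures.HodgeRepro2.T6N5LocalRamHyp
import Summits.Ventures.HodgeRepro2.T6N5LocalRam
import Summits.Ventures.HodgeRepro2.T6N5LocalRamWeil
import Summits.Ventures.HodgeRepro2.T6N5LocalInertCompletion
import Summits.Ventures.HodgeRepro2.T6N5LocalRamCompletion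
import Summits.Ventures.HodgeRepro2.T6N5LocalInertOnCompletion
import Summits.Ventures.HodgeRepro2.T6N5LocalRamOnCompletion
import Summits.Ventures.HodgeRepro2.T6N5LocalRamOnCompletionAll
import Summits.Ventures.HodgeRepro2.T6N5LocalOnCompletionIndex
import Summits.Ventures.HodgeRepro2.T6N5LocalTateChars
import Summits.Ventures.HodgeRepro2.T6N5LocalInertTateSide
import Summits.Ventures.HodgeRepro2.T6N5LocalRamTateSide
import Summits.Ventures.HodgeRepro2.T6N5LocalOnCompletionWeil
import Summits.Ventures.HodgeRepro2.T6N5LocalWeilQuotient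

/-!
# T6N5LocalWeilQuotientSmooth — Tier 6, M2 sub-step N5 (t6-p8's half): THE PER-PLACE STATEMENTS OF RECORD, v2 —
Theorem N5.T2 on Mathlib's completions with `U(V) = E_v^×/F_v^×`, the Epsilon Dichotomy restricted to the print's
characters, and the carried Weil representation smooth for the open subgroups

`T6N5LocalWeilQuotient.N5Local_main_inert_completion_weil'` / `N5Local_main_ram_completion_weil'` (p409783) consume
the display `BFGYYZ2025_Thm3_5` over EVERY homomorphism `E_v^× →* ℂˣ`; with the finite-index smoothness `hsm` that is
jointly unsatisfiable on a genuine local field (`T6N5LocalWeilQuotientKer`: the two force every conjugate-orthogonal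
character, continuous or not, to have a finite-index kernel). This file is the repaired statement of record:
* `IsSmoothOpenQ R U s` — open smoothness of the carried Weil representation over `E_v^×/F_v^×`: every vector is
  fixed by the image of some principal-unit subgroup `U_E^n` (an open subgroup of the compact group `U(V)`);
* `N5Local_main_inert_completion_weil''` / `N5Local_main_ram_completion_weil''` — exactly the hypotheses of the primed
  statements with `h35` replaced by `BFGYYZ2025_Thm3_5_smooth … IsSmooth` (the print's characters,
  `T6N5LocalHypSmooth`) and the open smoothness `hsmU` added next to `hsm` (both properties of a smooth
  representation of the compact group `U(V)`); everything else (the place data, `ψ_δ`, the printed displays on the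
  ε-factor parameter, non-vanishing, `ϵ_δ(W) = 1`, `χ_W` conjugate-symplectic) is unchanged, and every character-side
  and Tate-side datum condition stays a kernel theorem.
README §8(d): uses an L-value-free non-vanishing device: NO.
-/

namespace Summit.Ventures.HodgeRepro2.T6.N5LocalWeilQuotientSmooth

open Summit.Ventures.HodgeRepro2 IsDedekindDomain HeightOneSpectrum
  Summit.Ventures.HodgeRepro2.T6.N5LocalDatum Summit.Ventures.HodgeRepro2.T6.N5LocalWeil
  Summit.Ventures.HodgeRepro2.T6.N5LocalCharDatum Summit.Ventures.HodgeRepro2.T6.N5LocalInertDatum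
  Summit.Ventures.HodgeRepro2.T6.N5LocalRamDatum Summit.Ventures.HodgeRepro2.T6.N5Local
  Summit.Ventures.HodgeRepro2.T6.N5LocalSmooth
  Summit.Ventures.HodgeRepro2.T6.N5LocalInertWeil Summit.Ventures.HodgeRepro2.T6.N5LocalRamWeil
  Summit.Ventures.HodgeRepro2.T6.Hyp Summit.Ventures.HodgeRepro2.T6.N5LocalInertCompletion
  Summit.Ventures.HodgeRepro2.T6.N5LocalRamCompletion Summit.Ventures.HodgeRepro2.T6.N5LocalInertOnCompletion
  Summit.Ventures.HodgeRepro2.T6.N5LocalRamOnCompletion Summit.Ventures.HodgeRepro2.T6.N5LocalTateChars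
  Summit.Ventures.HodgeRepro2.T6.N5LocalInertTateSide Summit.Ventures.HodgeRepro2.T6.N5LocalRamTateSide
  Summit.Ventures.HodgeRepro2.T6.N5LocalOnCompletionWeil Summit.Ventures.HodgeRepro2.T6.N5LocalWeilQuotient

-- `K`, `L` in `Type` (universe `0`).
variable {K : Type} [Field K] [NumberField K] (v : HeightOneSpectrum (NumberField.RingOfIntegers K))
  {L : Type} [Field L] [NumberField L] [Algebra K L] (w : HeightOneSpectrum (NumberField.RingOfIntegers L))
  [w.asIdeal.LiesOver v.asIdeal]
  [ContinuousSMul (v.adicCompletion K) (w.adicCompletion L)]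
  [IsScalarTower K (v.adicCompletion K) (w.adicCompletion L)]

noncomputable section

omit [ContinuousSMul (v.adicCompletion K) (w.adicCompletion L)]
  [IsScalarTower K (v.adicCompletion K) (w.adicCompletion L)] in
/-- Open smoothness of the carried Weil representation of `V_s` over `U(V) = E_v^×/F_v^×`: every vector is fixed by
the image of some member `U n` of the principal-unit filtration of `E_v^×` (an open subgroup of `U(V)`). -/
def IsSmoothOpenQ (R : WeilRep v w) (U : ℕ → Subgroup (w.adicCompletion L)ˣ) (s : ℤˣ) : Prop :=
  ∀ x : R.Wsp s, ∃ n : ℕ, ∀ u ∈ U n, R.ωWeil s (toMulAdd v w u) x = x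

/-! ### Inert places -/

section Inert

variable (h2 : Module.finrank (v.adicCompletion K) (w.adicCompletion L) = 2)
  {ϖ : v.adicCompletionIntegers K} (hϖ : Irreducible ϖ)
  (hϖS : Irreducible (algebraMap (v.adicCompletionIntegers K) (w.adicCompletionIntegers L) ϖ))
  (σ : Gal(w.adicCompletion L/v.adicCompletion K)) (hσ : σ ≠ 1)
  (P : TateParams (w.adicCompletion L)ˣ (PsiC w) ℝ) (ψδ : PsiC w)
  (hK : ∀ a : v.adicCompletion K, ψδ.1 (algebraMap (v.adicCompletion K) (w.adicCompletion L) a) = 1)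
  (R : WeilRep v w)

omit [IsScalarTower K (v.adicCompletion K) (w.adicCompletion L)] in
/-- `ofOne` of the quotient carrier is the inflation through the quotient map (inert datum). -/
theorem ofOne_eq_inert (α : AddChar (QuotA v w) ℂ) (x : (w.adicCompletion L)ˣ) :
    (((mkInertWeil v w h2 hϖ hϖS σ hσ P ψδ hK (toCarrier v w R)).ofOne α x : ℂˣ) : ℂ) =
      α (Multiplicative.toAdd (toMulAdd v w x)) :=
  ofOneQ_apply v w α x

omit [IsScalarTower K (v.adicCompletion K) (w.adicCompletion L)] in
/-- Open smoothness on the quotient carrier is `InertIsSmoothOpen` for the inert datum. -/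
theorem inertIsSmoothOpen_of (s : ℤˣ) (h : IsSmoothOpenQ v w R (U v w ϖ) s) :
    InertIsSmoothOpen (mkInertWeil v w h2 hϖ hϖS σ hσ P ψδ hK (toCarrier v w R)) (toMulAdd v w) s :=
  h

/-- THEOREM N5.T2 AT AN INERT PLACE — THE STATEMENT OF RECORD, v2: `N5Local_main_inert_completion_weil'` with the
Epsilon Dichotomy restricted to the print's characters (`h35`) and the open smoothness of the Weil representation
(`hsmU`) next to the finite-index smoothness (`hsm`). Hypotheses: the place data, `ψ_δ`, the displays `hG` / `hT` /
`h35`, the Weil representations' smoothness (`hsm`, `hsmU`) and non-vanishing, `ϵ_δ(W) = 1`, `χ_W`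
conjugate-symplectic. -/
theorem N5Local_main_inert_completion_weil''
    (hf : 2 ≤ (Ideal.span {ϖ}).inertiaDeg'
      (Ideal.span {algebraMap (v.adicCompletionIntegers K) (w.adicCompletionIntegers L) ϖ}))
    (hG : GGP2012ex_Prop3_1 (mkInertWeil v w h2 hϖ hϖS σ hσ P ψδ hK (toCarrier v w R)).D)
    (hT : Tate1979_3_2_2_3 P.epsT (fun ξ a => ((ξ a : ℂˣ) : ℂ)) (twist w) (fun r m => r * m) (nrm w)
      (fun _ => True))
    (h35 : BFGYYZ2025_Thm3_5_smooth
      (mkInertWeil v w h2 hϖ hϖS σ hσ P ψδ hK (toCarrier v w R)).toWeil.toLocalSignDatum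
      (mkInertWeil v w h2 hϖ hϖS σ hσ P ψδ hK (toCarrier v w R)).D.IsSmooth)
    (hsm : ∀ s, (mkInertWeil v w h2 hϖ hϖS σ hσ P ψδ hK (toCarrier v w R)).toWeil.IsSmoothCompact s)
    (hsmU : ∀ s, IsSmoothOpenQ v w R (U v w ϖ) s)
    [∀ s, Nontrivial (R.Wsp s)]
    (hW : P.epsdW = 1)
    (hχW : (mkInertWeil v w h2 hϖ hϖS σ hσ P ψδ hK (toCarrier v w R)).toWeil.toLocalSignDatum.IsCS P.χW) :
    ∃ ξ : Fin 4 → (w.adicCompletion L)ˣ →* ℂˣ,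
      LocalSolution (mkInertWeil v w h2 hϖ hϖS σ hσ P ψδ hK (toCarrier v w R)).toWeil.toLocalSignDatum ξ := by
  refine N5Local_main_inert_weil_smooth (mkInertWeil v w h2 hϖ hϖS σ hσ P ψδ hK (toCarrier v w R))
    (toMulAdd v w) (ofOne_eq_inert v w h2 hϖ hϖS σ hσ P ψδ hK R) hG hT
    (conventions_mk v w h2 hϖ hϖS σ hσ P ψδ hK) (U_antitone v w ϖ) (ψδ_eq_twist v w h2 hϖ hϖS σ hσ ψδ hK)
    (tE_mem_Fsub v w h2 hϖ hϖS σ hσ ψδ hK) (ηF_tE v w h2 hϖ hϖS σ hσ ψδ hK) ⟨h2, hϖS⟩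
    (isNormalisedC_ψ0C v w h2 hϖ hϖS) ?_ ?_ h35 hsm
    (fun s => inertIsSmoothOpen_of v w h2 hϖ hϖS σ hσ P ψδ hK R s (hsmU s))
    (isCO_ofOneQ_inert v w h2 hϖ hϖS σ hσ P ψδ hK R) hW
    (N5LocalInertOnCompletion.ηF_mul_self v w σ (T5LocalNormIndex.index_normGroup_eq_two v w σ h2 hσ)) hχW
  · refine ⟨μ w, ?_, μ_mem_U_zero v w ϖ⟩
    rw [CharDatum.isCS_iff]
    intro x
    exact μ_eq_ηF v w σ hσ h2 hϖ hϖS _ x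
  · intro n hn
    obtain ⟨β, hβF, hβs, hβc⟩ := exists_CO_exact_level v w hϖ hϖS hf n hn
    refine ⟨β, ?_, hβs, hβc⟩
    rw [CharDatum.isCO_iff]
    intro x
    exact hβF x.1 x.2

end Inert

/-! ### Ramified places (tame or wild) -/

section Ram

variable (h2 : Module.finrank (v.adicCompletion K) (w.adicCompletion L) = 2)
  {ϖ : v.adicCompletionIntegers K} (hϖ : Irreducible ϖ) {π : w.adicCompletionIntegers L} (hπ : Irreducible π)
  (hram : ¬ Irreducible (algebraMap (v.adicCompletionIntegers K) (w.adicCompletionIntegers L) ϖ))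
  (σ : Gal(w.adicCompletion L/v.adicCompletion K)) (hσ : σ ≠ 1)
  (P : TateParams (w.adicCompletion L)ˣ (PsiC w) ℝ) (ψδ : PsiC w)
  (R : WeilRep v w)

omit [ContinuousSMul (v.adicCompletion K) (w.adicCompletion L)]
  [IsScalarTower K (v.adicCompletion K) (w.adicCompletion L)] in
/-- `ofOne` of the quotient carrier is the inflation through the quotient map (ramified datum). -/
theorem ofOne_eq_ram (α : AddChar (QuotA v w) ℂ) (x : (w.adicCompletion L)ˣ) :
    (((mkRamWeil v w h2 hπ σ hσ P ψδ (toCarrier v w R)).ofOne α x : ℂˣ) : ℂ) =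
      α (Multiplicative.toAdd (toMulAdd v w x)) :=
  ofOneQ_apply v w α x

omit [ContinuousSMul (v.adicCompletion K) (w.adicCompletion L)]
  [IsScalarTower K (v.adicCompletion K) (w.adicCompletion L)] in
/-- Open smoothness on the quotient carrier is `RamIsSmoothOpen` for the ramified datum. -/
theorem ramIsSmoothOpen_of (s : ℤˣ) (h : IsSmoothOpenQ v w R (Uπ w π) s) :
    RamIsSmoothOpen (mkRamWeil v w h2 hπ σ hσ P ψδ (toCarrier v w R)) (toMulAdd v w) s :=
  h

include hϖ hram in
/-- THEOREM N5.T2 AT EVERY FINITE RAMIFIED PLACE (tame or wild) — THE STATEMENT OF RECORD, v2: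
`N5Local_main_ram_completion_weil'` with the Epsilon Dichotomy restricted to the print's characters (`h35`) and the
open smoothness of the Weil representation (`hsmU`) next to the finite-index smoothness (`hsm`). -/
theorem N5Local_main_ram_completion_weil''
    (hK : ∀ a : v.adicCompletion K, ψδ.1 (algebraMap (v.adicCompletion K) (w.adicCompletion L) a) = 1)
    (hT6 : Tate1979_3_2_6_3 (mkRamWeil v w h2 hπ σ hσ P ψδ (toCarrier v w R)).D)
    (hG : GGP2012_Prop5_1_2 (mkRamWeil v w h2 hπ σ hσ P ψδ (toCarrier v w R)).D)
    (h35 : BFGYYZ2025_Thm3_5_smooth (mkRamWeil v w h2 hπ σ hσ P ψδ (toCarrier v w R)).toWeil.toLocalSignDatum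
      (mkRamWeil v w h2 hπ σ hσ P ψδ (toCarrier v w R)).D.IsSmooth)
    (hsm : ∀ s, (mkRamWeil v w h2 hπ σ hσ P ψδ (toCarrier v w R)).toWeil.IsSmoothCompact s)
    (hsmU : ∀ s, IsSmoothOpenQ v w R (Uπ w π) s)
    [∀ s, Nontrivial (R.Wsp s)]
    (hW : P.epsdW = 1)
    (hχW : (mkRamWeil v w h2 hπ σ hσ P ψδ (toCarrier v w R)).toWeil.toLocalSignDatum.IsCS P.χW) :
    ∃ ξ : Fin 4 → (w.adicCompletion L)ˣ →* ℂˣ,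
      LocalSolution (mkRamWeil v w h2 hπ σ hσ P ψδ (toCarrier v w R)).toWeil.toLocalSignDatum ξ := by
  refine N5Local_main_ram_weil_smooth (mkRamWeil v w h2 hπ σ hσ P ψδ (toCarrier v w R)) (toMulAdd v w)
    (ofOne_eq_ram v w h2 hπ σ hσ P ψδ R) hT6 hG (Uπ_antitone w π)
    (omega_half_unramified w π) (isConjInvC_of_trivial_on_base v w h2 σ hσ ψδ hK) ?_ ?_ ?_ h35 hsm
    (fun s => ramIsSmoothOpen_of v w h2 hπ σ hσ P ψδ R s (hsmU s))
    (isCO_ofOneQ_ram v w h2 hπ σ hσ P ψδ R) hW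
    (N5LocalRamOnCompletion.ηF_mul_self v w σ (T5LocalNormIndex.index_normGroup_eq_two v w σ h2 hσ)) hχW
  · -- `hμ`
    refine ⟨μ w, ?_, μ_mem_Uπ_zero w π, ?_, μ_sq w⟩
    · rw [CharDatum.isCO_iff]
      intro x
      exact μ_isCO v w h2 hϖ hπ hram x.1 x.2
    · show ((μ w (T5LocalFieldUnitsDecomposition.uniformizerUnit π hπ) : ℂˣ) : ℂ) = -1
      rw [μ_uniformizer w hπ]
      rfl
  · -- `hodd` (every ramified place: p4's `T5RamifiedOddConductor`)
    obtain ⟨ω, hωF, hωs, hωc⟩ :=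
      T5RamifiedOddConductor.exists_CS_odd_level_of_ramified v w h2 hϖ hπ hram σ hσ
        (T5LocalNormIndex.index_normGroup_eq_two v w σ h2 hσ)
    refine ⟨ω, ?_, hωs, hωc⟩
    rw [CharDatum.isCS_iff]
    intro x
    exact hωF x
  · -- `heven`
    intro k
    obtain ⟨β, hβF, hβs, hβc⟩ := exists_CO_exact_even_level v w h2 hϖ hπ hram k
    refine ⟨β, ?_, hβs, ?_, ?_⟩
    · rw [CharDatum.isCO_iff]
      intro x
      exact hβF x.1 x.2
    · show Even (T5ConductorArithmetic.conductor (Uπ w π) β)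
      rw [hβc]
      exact ⟨k + 1, by ring⟩
    · show k < T5ConductorArithmetic.conductor (Uπ w π) β
      rw [hβc]
      omega

end Ram

end

end Summit.Ventures.HodgeRepro2.T6.N5LocalWeilQuotientSmooth
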